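/-
Origin: expansion seat `planner-pub-hodgecm-pv05-g4-0`, handover #1 2026-08-18T07:49:33Z (`HOME/pub-hodgecm-pv05-g4/lean/Pv05g4/FockSeesaw.lean`, md5 b2bf3661, 662 lines);
landed by the gen-7 packager in gate run 26 as `HodgeCM/PerL34/FockSeesaw.lean` (verbatim).
-/
/-
Origin: HOME/pub-hodgecm-pv05-g4/lean/Pv05g4/FockSeesaw.lean — session planner-pub-hodgecm-pv05-g4-0 (unit pub-hodgecm-pv05-g4,
DAG-node prover #05 gen 4), node `FockSeesaw` (CLAIM HOME/STATUS.md 2026-08-18T07:41Z).  Intended final place: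
`HodgeCM/PerL34/FockSeesaw.lean`.  Imports ONLY the landed `HodgeCM.PerL34.FockGL3` (pv05-g3, gate run 23) and
`HodgeCM.PerL34.FockAddenda` (pv12, gate run 21) + Mathlib; asserts nothing, cites nothing as a hypothesis.
-/
import Mathlib.RingTheory.TensorProduct.MvPolynomial
import Mathlib.Algebra.Algebra.Equiv
import Summits.HodgeConjecture.HodgeCM.PerL34.FockGL3
import Summits.HodgeConjecture.HodgeCM.PerL34.FockAddenda

set_option autoImplicit false

/-!
# Lemma 3.4 (seesaw), ARCHIMEDEAN CLAUSE at `ι₁`: `𝓕(V₃⊗W) = 𝓕(V₃⊗W₁) ⊗ 𝓕(V₃⊗W₂)` and `ω_W|_{T×G_U} = ω_{W₁} ⊗ ω_{W₂}`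
# on the polynomial Fock models — the junction of pv05's one-line oscillator shell with pv12's plane shell

NODE.  LEMMAS.md §1 row **N17** (`lem:seesaw`, PerL v5 Lemma 3.4, tex ll. 319–337; owner pv11, whose `Seesaw.lean`
carries the GLOBAL statement over the lattice-sum shell with the group-level compatibility as the PRINT-DERIVED field
`ThetaSeesawData.RestrictTmul`).  This file proves the lemma's archimedean ingredient, VERBATIM (tex ll. 319–322):

> For an allowed pair of type $(12)$ and $\phi_j\in\cS((V_3\otimes W_j)(\A))$: $\cS((V_3\otimes W)(\A))=\cS((V_3\otimes
> W_1)(\A))\otimes\cS((V_3\otimes W_2)(\A))$ (algebraic tensor product), $\omega_{W,\mu_W}|_{T(\A)\times G_U(\A)}\cong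
> \omega_{W_1,\mu_1}\otimes\omega_{W_2,\mu_2}$ under this identification, …

with its proof sentence (tex ll. 329–331):

> The tensor decomposition is exact because … at the archimedean places the Fock model of $V_3\otimes(W_1\oplus W_2)$
> is the polynomial ring in the union of the two sets of variables.

at the real place `ι₁` (signature `(2,1)` for `V₃`, two lines of the same sign for `W = W₁ ⊕ W₂`), on the `K`-finite
(polynomial) vectors and INFINITESIMALLY in `G_U` (the action of `𝔲(V₃)_ℂ = 𝔤𝔩₃(ℂ)`) and in `T = U(W₁) × U(W₂)` (the
action of its Lie algebra = the two column-weight operators).  (i) VERBATIM CHECK: the LEMMAS.md §5 N17 text and the tex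
agree; nothing of the global statement (Schwartz–Bruhat spaces at finite places, the splitting characters `μ_j`, the
theta kernels, (eq:seesaw)) is touched here — those remain pv11's `ThetaSeesawData` fields / theorems
(`thetaKernel_tmul`, `eq_seesaw`).

(ii) KIND: **KERNEL, hypothesis-free** (every statement below is a theorem about explicit polynomial differential
operators; no structure with fields, no `Prop`-valued input).  What is proved, BY NAME over the two landed shells —
pv05-g3 `Fock.osc` / `Fock.oscRep : 𝔤𝔩₃(ℂ) →ₗ⁅ℂ⁆ End ℂ[z₁,z₂,w]` (`FockGL3`) and pv12 `Fock.PlaneModel = ℂ[z_{aj}, w_j]`,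
`Fock.lineEmb`, `Fock.pairMap`, `Fock.Eplus/Eminus/rowWt/wWt/colWt/detZ/IsKappaVector` (`ArchB`, `FockAddenda`):

* §1–2 **exactness of the tensor decomposition**: `varEquiv : HarmVar ⊕ HarmVar ≃ PlaneVar` ("the union of the two
  sets of variables"), `pairEquiv : HarmModel ⊗[ℂ] HarmModel ≃ₐ[ℂ] PlaneModel` (Mathlib `MvPolynomial.tensorEquivSum` +
  renaming), `pairEquiv_apply : pairEquiv x = pairMap x`, hence **`pairMap_bijective`** — pv12's multiplication map
  `φ ⊗ ψ ↦ φ(z_{·0},w_0) ψ(z_{·1},w_1)` IS an algebra isomorphism;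
* §3–4 **compatibility of the Weil representations, `G_U`-side**: the oscillator operator of the matrix unit `E_{ik}` in
  renamed variables `oscAt ℓ i k` (`osc = oscAt id`, `osc_eq_oscAt`), its locality `oscAt_rename_mul`; the two
  commuting copies `lineOsc 0`, `lineOsc 1` inside the plane model (`lineOsc_zero_mul`, `lineOsc_one_mul`,
  `lineOsc_zero_one_comm` — the action of `𝔲(V)_ℂ ⊕ 𝔲(V)_ℂ`, the big member of the seesaw pair
  `(U(W₁)×U(W₂), U(V)×U(V))`), their DIAGONAL `planeOsc i k` = the nine explicit operators
  `Σ_j z_{aj}∂_{z_{bj}} + 2δ_{ab}`, `−Σ_j w_j∂_{w_j}`, `Σ_j z_{aj}w_j`, `−Σ_j ∂_{z_{aj}}∂_{w_j}`, and the **seesaw identity**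
  `planeOsc_pairMap_tmul : planeOsc i k (pairMap (φ ⊗ ψ)) = pairMap (osc i k φ ⊗ ψ) + pairMap (φ ⊗ osc i k ψ)`
  (`ω_W(X) = ω_{W₁}(X) ⊗ 1 + 1 ⊗ ω_{W₂}(X)`), in operator form `planeOsc_comp_pairMap`; the Lie-algebra packaging
  `tensorDer : End M →ₗ⁅ℂ⁆ End (M ⊗ M)` (`A ↦ A⊗1 + 1⊗A`), `planeOscRep : 𝔤𝔩₃(ℂ) →ₗ⁅ℂ⁆ End(PlaneModel)` (transport of
  `oscRep ⊗ 1 + 1 ⊗ oscRep` along `pairEquiv`) with `planeOscRep_single : planeOscRep E_{ik} = planeOsc i k`,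
  `planeOscRep_pairMap_tmul` (the identity for every `A ∈ 𝔤𝔩₃`), and the commutation relations `planeOsc_lie` /
  `planeOsc_comm` INHERITED from pv05-g3's `osc_comm` (no second 81-case computation);
* §5 **compatibility, `T`-side, and the dictionary with `ArchB`**: `T = U(W₁)×U(W₂)` acts FACTORWISE —
  `weightOp_colWt_zero_pairMap_tmul : colWt 0 (φψ) = (uWt φ) ψ`, `weightOp_colWt_one_pairMap_tmul` — so `F_k ⊗ F_l`
  (pv05-g3 `hpiece`) lands in `T`-weight `(k,l)` (`weightOp_colWt_pairMap_tmul_of_mem`, the `U(1)²`-bookkeeping of node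
  N19-gen at `ι₁`); the `K_V`-torus is diagonal (`weightOp_rowWt_pairMap_tmul`, `weightOp_wWt_pairMap_tmul`); pv12's
  `Eplus = planeOsc E_{12}`, `Eminus = planeOsc E_{21}` (`planeOsc_inl_zero_inl_one`, `planeOsc_inl_one_inl_zero`),
  `planeOsc E_{aa} = rowWt_a + 2`, `planeOsc E_{33} = −wWt`; hence N28's **`IsKappaVector f ↔` `f` is a `𝔨′`-weight
  vector of the diagonal action with `ω_W(E_{11}) f = ω_W(E_{22}) f = 3f`, `ω_W(E_{33}) f = 0`, killed by `ω_W(E_{12})`,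
  `ω_W(E_{21})`** (`isKappaVector_iff_planeOsc`), and `det(z) = pairMap (z₁⊗z₂ − z₂⊗z₁)` is `ω_W(𝔭′⁻)`-harmonic
  (`planeOsc_pMinus_detZ`).

NORMALISATION (stated, not an input).  pv05-g3's `osc` is the genuine `K̃′`-normalised Fock action twisted by the
central character `½·tr` (integral shifts `+δ_{ab}`, `0`); central characters ADD under `⊗`, so the diagonal operators
here have constant term `2δ_{ab}` on the `𝔤𝔩₂` block (`planeOsc E_{ab} = Σ_j (z_{aj}∂_{bj} + δ_{ab})`), i.e. `+δ_{ab} = tr`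
relative to the genuine `ω_W`, whose constants have weight `(1,1;−1)` — for `dim W = 2` the genuine shifts `Σ_j ½ = 1`
are themselves integral.  Brackets, invariant subspaces, root operators and the `T`-weights are unaffected;
the comparison of either normalisation with the printed formulas (Adams 2007 §§4–6, [KV78] III §5) is DICTIONARY item
(i) of GAPS `pv05g3-K1`, owned by pv12-g6 (`FockPrintDictionary`, run 26) — not made here.

PRINT / DICTIONARY residual of N17 (unchanged, pv11 `Seesaw.lean` docstring): the GROUP-level, GLOBAL compatibility
`ω_{W,μ_W}|_{T(𝔸)×G_U(𝔸)} ≅ ω_{W₁,μ₁} ⊗ ω_{W₂,μ₂}` incl. Kudla's splitting being multiplicative in orthogonal sums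
([HKS] §1 (1.13)–(1.16) p. 952, [GI] §4, [Ku94] Thm 3.1) and the Schwartz–Bruhat tensor decomposition at the finite
places.  What this file removes from that residual is its archimedean `K`-finite / infinitesimal part at `ι₁`, which is
now a theorem about the explicit models both neighbouring lineages already use.

PACKAGER: additive leaf; nothing imports it; both `HodgeCM.*` imports are tree names (no rewrite); uses
`attribute [local instance 100] LieRing.ofAssociativeRing` file-locally exactly as `FockGL3` does; axioms of every
declaration = {propext, Classical.choice, Quot.sound} (`Pv05g4/AxCheckFockSeesaw.lean`).
-/

namespace HodgeCM

namespace PerL34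

namespace Fock

open MvPolynomial Finsupp

open scoped BigOperators TensorProduct

attribute [local instance 100] LieRing.ofAssociativeRing

/-! ## 1. The union of the two sets of variables: `HarmVar ⊕ HarmVar ≃ PlaneVar` -/

section Variables

/-- Line `j`'s copy of a one-line variable among the plane variables: `z_a ↦ z_{a j}`, `w ↦ w_j`. -/
def lineVar (j : Fin 2) : HarmVar → PlaneVar
  | Sum.inl a => Sum.inl (a, j)
  | Sum.inr _ => Sum.inr j

/-- (Ported verbatim from the HodgeCMPerL package; no docstring in the source.) -/
@[simp] theorem lineVar_inl (j a : Fin 2) : lineVar j (Sum.inl a) = Sum.inl (a, j) := rfl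

/-- (Ported verbatim from the HodgeCMPerL package; no docstring in the source.) -/
@[simp] theorem lineVar_inr (j : Fin 2) (u : Unit) : lineVar j (Sum.inr u) = Sum.inr j := rfl

/-- (Ported verbatim from the HodgeCMPerL package; no docstring in the source.) -/
theorem lineVar_injective (j : Fin 2) : Function.Injective (lineVar j) := by
  intro u v h
  rcases u with a | ⟨⟩ <;> rcases v with b | ⟨⟩ <;> simp_all [lineVar]

/-- (Ported verbatim from the HodgeCMPerL package; no docstring in the source.) -/
theorem lineVar_ne (j j' : Fin 2) (h : j ≠ j') (u v : HarmVar) : lineVar j u ≠ lineVar j' v := by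
  rcases u with a | ⟨⟩ <;> rcases v with b | ⟨⟩ <;> simp [lineVar, h]

/-- The inverse assignment: which line and which one-line variable a plane variable is. -/
def unlineVar : PlaneVar → HarmVar ⊕ HarmVar
  | Sum.inl (a, j) => if j = 0 then Sum.inl (Sum.inl a) else Sum.inr (Sum.inl a)
  | Sum.inr j => if j = 0 then Sum.inl (Sum.inr ()) else Sum.inr (Sum.inr ())

/-- **"the polynomial ring in the union of the two sets of variables"** (PerL v5 l. 330–331): the plane variables
`{z_{aj}, w_j}` are the disjoint union of line `0`'s and line `1`'s copies of the one-line variables `{z_a, w}`. -/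
def varEquiv : HarmVar ⊕ HarmVar ≃ PlaneVar where
  toFun := Sum.elim (lineVar 0) (lineVar 1)
  invFun := unlineVar
  left_inv := by
    intro x
    rcases x with (a | ⟨⟩) | (a | ⟨⟩) <;> simp [lineVar, unlineVar]
  right_inv := by
    intro v
    rcases v with ⟨a, j⟩ | j <;> fin_cases j <;> simp [lineVar, unlineVar]

/-- (Ported verbatim from the HodgeCMPerL package; no docstring in the source.) -/
@[simp] theorem varEquiv_inl (u : HarmVar) : varEquiv (Sum.inl u) = lineVar 0 u := rfl

/-- (Ported verbatim from the HodgeCMPerL package; no docstring in the source.) -/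
@[simp] theorem varEquiv_inr (u : HarmVar) : varEquiv (Sum.inr u) = lineVar 1 u := rfl

end Variables

/-! ## 2. The tensor decomposition `𝓕(V₃⊗W) = 𝓕(V₃⊗W₁) ⊗ 𝓕(V₃⊗W₂)` is EXACT on the polynomial Fock models -/

section PairEquiv

/-- pv12's line embedding `lineEmb j` (`FockAddenda`) IS the renaming along `lineVar j`. -/
theorem lineEmb_eq_rename (j : Fin 2) : (lineEmb j : HarmModel →ₐ[ℂ] PlaneModel) = rename (lineVar j) := by
  refine MvPolynomial.algHom_ext fun v => ?_
  rcases v with a | ⟨⟩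
  · rw [rename_X]; exact lineEmb_hz j a
  · rw [rename_X]; exact lineEmb_hw j

/-- (Ported verbatim from the HodgeCMPerL package; no docstring in the source.) -/
theorem lineEmb_apply (j : Fin 2) (φ : HarmModel) : lineEmb j φ = rename (lineVar j) φ := by
  rw [lineEmb_eq_rename]

/-- (Ported verbatim from the HodgeCMPerL package; no docstring in the source.) -/
@[simp] theorem lineEmb_X (j : Fin 2) (v : HarmVar) : lineEmb j (X v) = X (lineVar j v) := by
  rw [lineEmb_apply, rename_X]

/-- **The algebra isomorphism `ℂ[z_a, w] ⊗_ℂ ℂ[z_a, w] ≃ ℂ[z_{aj}, w_j]`** (PerL v5 Lemma 3.4, proof l. 329–331: "at the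
archimedean places the Fock model of `V₃⊗(W₁⊕W₂)` is the polynomial ring in the union of the two sets of variables"):
Mathlib's `MvPolynomial.tensorEquivSum` followed by the renaming `varEquiv`. -/
noncomputable def pairEquiv : HarmModel ⊗[ℂ] HarmModel ≃ₐ[ℂ] PlaneModel :=
  (MvPolynomial.tensorEquivSum ℂ HarmVar HarmVar ℂ).trans (renameEquiv ℂ varEquiv)

/-- (Ported verbatim from the HodgeCMPerL package; no docstring in the source.) -/
theorem pairEquiv_X_tmul_one (v : HarmVar) : pairEquiv (X v ⊗ₜ[ℂ] 1) = X (lineVar 0 v) := by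
  simp [pairEquiv]

/-- (Ported verbatim from the HodgeCMPerL package; no docstring in the source.) -/
theorem pairEquiv_one_tmul_X (v : HarmVar) : pairEquiv ((1 : HarmModel) ⊗ₜ[ℂ] X v) = X (lineVar 1 v) := by
  simp [pairEquiv]

/-- On `φ ⊗ 1` the isomorphism is line `0`'s embedding. -/
theorem pairEquiv_comp_includeLeft :
    (pairEquiv : HarmModel ⊗[ℂ] HarmModel ≃ₐ[ℂ] PlaneModel).toAlgHom.comp
        (Algebra.TensorProduct.includeLeft : HarmModel →ₐ[ℂ] HarmModel ⊗[ℂ] HarmModel) = lineEmb 0 := by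
  refine MvPolynomial.algHom_ext fun v => ?_
  rw [AlgHom.comp_apply, Algebra.TensorProduct.includeLeft_apply, lineEmb_X]
  exact pairEquiv_X_tmul_one v

/-- On `1 ⊗ ψ` the isomorphism is line `1`'s embedding. -/
theorem pairEquiv_comp_includeRight :
    (pairEquiv : HarmModel ⊗[ℂ] HarmModel ≃ₐ[ℂ] PlaneModel).toAlgHom.comp
        (Algebra.TensorProduct.includeRight : HarmModel →ₐ[ℂ] HarmModel ⊗[ℂ] HarmModel) = lineEmb 1 := by
  refine MvPolynomial.algHom_ext fun v => ?_
  rw [AlgHom.comp_apply, Algebra.TensorProduct.includeRight_apply, lineEmb_X]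
  exact pairEquiv_one_tmul_X v

/-- On pure tensors: `pairEquiv (φ ⊗ ψ) = φ(z_{·0}, w_0) · ψ(z_{·1}, w_1)`. -/
theorem pairEquiv_tmul (φ ψ : HarmModel) : pairEquiv (φ ⊗ₜ[ℂ] ψ) = lineEmb 0 φ * lineEmb 1 ψ := by
  have h1 : pairEquiv (φ ⊗ₜ[ℂ] (1 : HarmModel)) = lineEmb 0 φ := by
    rw [← pairEquiv_comp_includeLeft]; rfl
  have h2 : pairEquiv ((1 : HarmModel) ⊗ₜ[ℂ] ψ) = lineEmb 1 ψ := by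
    rw [← pairEquiv_comp_includeRight]; rfl
  rw [← h1, ← h2, ← map_mul, Algebra.TensorProduct.tmul_mul_tmul, mul_one, one_mul]

/-- **`pairEquiv` IS pv12's multiplication map `pairMap`** (`FockAddenda`): the tensor decomposition used by
`isKappaVector_iff_wedge` is an isomorphism, not merely a map. -/
theorem pairEquiv_apply (x : HarmModel ⊗[ℂ] HarmModel) : pairEquiv x = pairMap x := by
  induction x using TensorProduct.induction_on with
  | zero => rw [map_zero, map_zero]
  | tmul φ ψ => rw [pairEquiv_tmul, pairMap_tmul]
  | add x y hx hy => rw [map_add, map_add, hx, hy]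

/-- (Ported verbatim from the HodgeCMPerL package; no docstring in the source.) -/
theorem coe_pairEquiv_eq : ((pairEquiv : HarmModel ⊗[ℂ] HarmModel ≃ₐ[ℂ] PlaneModel) : _ →ₐ[ℂ] PlaneModel) = pairMap :=
  AlgHom.ext pairEquiv_apply

/-- **Exactness of the tensor decomposition at `ι₁`** (PerL v5 Lemma 3.4, first assertion, archimedean clause):
`𝓕(V₃⊗W₁) ⊗ 𝓕(V₃⊗W₂) → 𝓕(V₃⊗W)`, `φ ⊗ ψ ↦ φψ`, is a bijection. -/
theorem pairMap_bijective : Function.Bijective (pairMap : HarmModel ⊗[ℂ] HarmModel →ₐ[ℂ] PlaneModel) := by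
  have h : ⇑(pairMap : HarmModel ⊗[ℂ] HarmModel →ₐ[ℂ] PlaneModel) = ⇑pairEquiv :=
    funext fun x => (pairEquiv_apply x).symm
  rw [h]
  exact pairEquiv.bijective

/-- The linear isomorphism underlying `pairEquiv` (used to transport operators). -/
noncomputable def pairLinearEquiv : HarmModel ⊗[ℂ] HarmModel ≃ₗ[ℂ] PlaneModel := pairEquiv.toLinearEquiv

/-- (Ported verbatim from the HodgeCMPerL package; no docstring in the source.) -/
@[simp] theorem pairLinearEquiv_apply (x : HarmModel ⊗[ℂ] HarmModel) : pairLinearEquiv x = pairMap x :=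
  pairEquiv_apply x

/-- (Ported verbatim from the HodgeCMPerL package; no docstring in the source.) -/
theorem pairLinearEquiv_symm_pairMap (x : HarmModel ⊗[ℂ] HarmModel) : pairLinearEquiv.symm (pairMap x) = x := by
  rw [← pairLinearEquiv_apply, LinearEquiv.symm_apply_apply]

/-- (Ported verbatim from the HodgeCMPerL package; no docstring in the source.) -/
theorem pairMap_pairLinearEquiv_symm (f : PlaneModel) : pairMap (pairLinearEquiv.symm f) = f := by
  rw [← pairLinearEquiv_apply, LinearEquiv.apply_symm_apply]

end PairEquiv

/-! ## 3. The oscillator operators of one line, written in renamed variables; the Leibniz/seesaw lemma -/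

section Shapes

variable {σ : Type*}

/-- The first-order operator `X_u ∂_v`. -/
noncomputable def xD (u v : σ) : Module.End ℂ (MvPolynomial σ ℂ) where
  toFun f := X u * pderiv v f
  map_add' f g := by simp only [map_add, mul_add]
  map_smul' c f := by simp only [Derivation.map_smul, mul_smul_comm, RingHom.id_apply]

/-- (Ported verbatim from the HodgeCMPerL package; no docstring in the source.) -/
@[simp] theorem xD_apply (u v : σ) (f : MvPolynomial σ ℂ) : xD u v f = X u * pderiv v f := rfl

/-- The multiplication operator `X_u X_v`. -/
noncomputable def mulXX (u v : σ) : Module.End ℂ (MvPolynomial σ ℂ) := LinearMap.mulLeft ℂ (X u * X v)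

/-- (Ported verbatim from the HodgeCMPerL package; no docstring in the source.) -/
@[simp] theorem mulXX_apply (u v : σ) (f : MvPolynomial σ ℂ) : mulXX u v f = X u * X v * f := rfl

/-- The second-order operator `∂_u ∂_v`. -/
noncomputable def dd (u v : σ) : Module.End ℂ (MvPolynomial σ ℂ) where
  toFun f := pderiv u (pderiv v f)
  map_add' f g := by simp only [map_add]
  map_smul' c f := by simp only [Derivation.map_smul, RingHom.id_apply]

/-- (Ported verbatim from the HodgeCMPerL package; no docstring in the source.) -/
@[simp] theorem dd_apply (u v : σ) (f : MvPolynomial σ ℂ) : dd u v f = pderiv u (pderiv v f) := rfl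

/-- **The oscillator operator of the matrix unit `E_{ik}` of `𝔤𝔩₃ = 𝔲(2,1)_ℂ` in variables renamed by `ℓ`** — the
common shape of pv05-g3's `osc` (`ℓ = id`) and of its two copies inside the plane model (`ℓ = lineVar j`):
`E_{ab} ↦ X_{ℓ z_a} ∂_{ℓ z_b} + δ_{ab}`, `E_{33} ↦ −X_{ℓ w} ∂_{ℓ w}`, `E_{a3} ↦ X_{ℓ z_a} X_{ℓ w}`, `E_{3a} ↦ −∂_{ℓ z_a} ∂_{ℓ w}`. -/
noncomputable def oscAt (ℓ : HarmVar → σ) : HarmVar → HarmVar → Module.End ℂ (MvPolynomial σ ℂ)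
  | Sum.inl a, Sum.inl b => xD (ℓ (Sum.inl a)) (ℓ (Sum.inl b)) + (if a = b then 1 else 0)
  | Sum.inr _, Sum.inr _ => -xD (ℓ (Sum.inr ())) (ℓ (Sum.inr ()))
  | Sum.inl a, Sum.inr _ => mulXX (ℓ (Sum.inl a)) (ℓ (Sum.inr ()))
  | Sum.inr _, Sum.inl a => -dd (ℓ (Sum.inl a)) (ℓ (Sum.inr ()))

/-- pv05-g3's `osc` IS the shape at `ℓ = id`. -/
theorem osc_eq_oscAt (i k : HarmVar) : osc i k = oscAt id i k := by
  apply LinearMap.ext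
  intro f
  rcases i with a | ⟨⟩ <;> rcases k with b | ⟨⟩
  · simp only [osc, oscAt, LinearMap.add_apply, hE_apply, xD_apply, id]
  · simp only [osc, oscAt, hP_apply, mulXX_apply, id, hz, hw]
  · simp only [osc, oscAt, LinearMap.neg_apply, hQ_apply, dd_apply, id]
  · simp only [osc, oscAt, LinearMap.neg_apply, hH_apply, xD_apply, id]

/-- **Leibniz / locality lemma.**  For an injective renaming `ℓ` and a cofactor `R` constant in the `ℓ`-variables,
the renamed oscillator operator acts on `rename ℓ φ · R` through the first factor only:
`oscAt ℓ E_{ik} (φ^ℓ · R) = (osc E_{ik} φ)^ℓ · R`. -/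
theorem oscAt_rename_mul {ℓ : HarmVar → σ} (hℓ : Function.Injective ℓ) (i k : HarmVar) (φ : HarmModel)
    (R : MvPolynomial σ ℂ) (hR : ∀ v : HarmVar, pderiv (ℓ v) R = 0) :
    oscAt ℓ i k (rename ℓ φ * R) = rename ℓ (osc i k φ) * R := by
  rcases i with a | ⟨⟩ <;> rcases k with b | ⟨⟩
  · simp only [oscAt, osc, LinearMap.add_apply, xD_apply, hE_apply, pderiv_mul, pderiv_rename hℓ, hR, mul_zero,
      add_zero, map_add, map_mul, rename_X]
    split_ifs
    · simp only [Module.End.one_apply]; ring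
    · simp only [LinearMap.zero_apply, add_zero, map_zero]; ring
  · simp only [oscAt, osc, mulXX_apply, hP_apply, hz, hw, map_mul, rename_X]
    ring
  · simp only [oscAt, osc, LinearMap.neg_apply, dd_apply, hQ_apply, pderiv_mul, pderiv_rename hℓ, hR, mul_zero,
      add_zero, map_neg, neg_mul]
  · simp only [oscAt, osc, LinearMap.neg_apply, xD_apply, hH_apply, pderiv_mul, pderiv_rename hℓ, hR, mul_zero,
      add_zero, map_neg, map_mul, rename_X, neg_mul, mul_assoc]

end Shapes

/-! ## 4. The two commuting `𝔤𝔩₃`-actions inside the plane model and their diagonal -/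

section Plane

/-- Line `j`'s variables do not occur in the other line's polynomials. -/
theorem pderiv_lineVar_lineEmb_of_ne {j j' : Fin 2} (h : j ≠ j') (v : HarmVar) (ψ : HarmModel) :
    pderiv (lineVar j v) (lineEmb j' ψ) = 0 := by
  classical
  apply pderiv_eq_zero_of_notMem_vars
  rw [lineEmb_apply]
  intro hv
  obtain ⟨u, -, hu⟩ := Finset.mem_image.mp (vars_rename _ _ hv)
  exact lineVar_ne j' j (Ne.symm h) u v hu

/-- Chain rule along the line embedding. -/
theorem pderiv_lineVar_lineEmb (j : Fin 2) (v : HarmVar) (φ : HarmModel) :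
    pderiv (lineVar j v) (lineEmb j φ) = lineEmb j (pderiv v φ) := by
  rw [lineEmb_apply, lineEmb_apply, pderiv_rename (lineVar_injective j)]

/-- **`ω_{W_j}(E_{ik})` realised inside the plane model**: line `j`'s copy of the oscillator operator, a differential
operator in the variables `z_{·j}, w_j` only. -/
noncomputable def lineOsc (j : Fin 2) : HarmVar → HarmVar → Module.End ℂ PlaneModel := oscAt (lineVar j)

/-- Line `0`'s operators act on `φ(z_{·0},w_0) ψ(z_{·1},w_1)` through `φ`: `(ω_{W₁}(X) ⊗ 1)(φ ⊗ ψ)`. -/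
theorem lineOsc_zero_mul (i k : HarmVar) (φ ψ : HarmModel) :
    lineOsc 0 i k (lineEmb 0 φ * lineEmb 1 ψ) = lineEmb 0 (osc i k φ) * lineEmb 1 ψ := by
  rw [lineOsc, lineEmb_apply 0 φ, lineEmb_apply 0 (osc i k φ)]
  exact oscAt_rename_mul (lineVar_injective 0) i k φ _
    fun v => pderiv_lineVar_lineEmb_of_ne (show (0 : Fin 2) ≠ 1 by decide) v ψ

/-- Line `1`'s operators act through `ψ`: `(1 ⊗ ω_{W₂}(X))(φ ⊗ ψ)`. -/
theorem lineOsc_one_mul (i k : HarmVar) (φ ψ : HarmModel) :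
    lineOsc 1 i k (lineEmb 0 φ * lineEmb 1 ψ) = lineEmb 0 φ * lineEmb 1 (osc i k ψ) := by
  rw [lineOsc, mul_comm (lineEmb 0 φ), mul_comm (lineEmb 0 φ), lineEmb_apply 1 ψ, lineEmb_apply 1 (osc i k ψ)]
  exact oscAt_rename_mul (lineVar_injective 1) i k ψ _
    fun v => pderiv_lineVar_lineEmb_of_ne (show (1 : Fin 2) ≠ 0 by decide) v φ

/-- In tensor language: `lineOsc 0 E ∘ pairMap = pairMap ∘ (osc E ⊗ 1)`. -/
theorem lineOsc_zero_comp_pairMap (i k : HarmVar) :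
    lineOsc 0 i k ∘ₗ (pairMap : HarmModel ⊗[ℂ] HarmModel →ₐ[ℂ] PlaneModel).toLinearMap =
      (pairMap : HarmModel ⊗[ℂ] HarmModel →ₐ[ℂ] PlaneModel).toLinearMap ∘ₗ (osc i k).rTensor HarmModel := by
  refine TensorProduct.ext' fun φ ψ => ?_
  simp only [LinearMap.comp_apply, AlgHom.toLinearMap_apply, LinearMap.rTensor_tmul, pairMap_tmul,
    lineOsc_zero_mul]

/-- In tensor language: `lineOsc 1 E ∘ pairMap = pairMap ∘ (1 ⊗ osc E)`. -/
theorem lineOsc_one_comp_pairMap (i k : HarmVar) :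
    lineOsc 1 i k ∘ₗ (pairMap : HarmModel ⊗[ℂ] HarmModel →ₐ[ℂ] PlaneModel).toLinearMap =
      (pairMap : HarmModel ⊗[ℂ] HarmModel →ₐ[ℂ] PlaneModel).toLinearMap ∘ₗ (osc i k).lTensor HarmModel := by
  refine TensorProduct.ext' fun φ ψ => ?_
  simp only [LinearMap.comp_apply, AlgHom.toLinearMap_apply, LinearMap.lTensor_tmul, pairMap_tmul,
    lineOsc_one_mul]

/-- The two copies commute (they are the action of `𝔲(V)_ℂ × 𝔲(V)_ℂ`, the big member of the seesaw pair
`(U(W₁)×U(W₂), U(V)×U(V))`). -/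
theorem lineOsc_zero_one_comm (i k i' k' : HarmVar) :
    lineOsc 0 i k * lineOsc 1 i' k' = lineOsc 1 i' k' * lineOsc 0 i k := by
  apply LinearMap.ext
  intro f
  obtain ⟨x, rfl⟩ := pairMap_bijective.2 f
  induction x using TensorProduct.induction_on with
  | zero => simp only [map_zero]
  | tmul φ ψ =>
      simp only [Module.End.mul_apply, pairMap_tmul, lineOsc_zero_mul, lineOsc_one_mul]
  | add x y hx hy => simp only [map_add, hx, hy]

/-- **`ω_W(E_{ik})` on the plane model = the DIAGONAL of the two copies**: the nine oscillator operators of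
`𝔤𝔩₃ = 𝔲(2,1)_ℂ` on `ℂ[z_{aj}, w_j]`: `E_{ab} ↦ Σ_j z_{aj}∂_{z_{bj}} + 2δ_{ab}`, `E_{33} ↦ −Σ_j w_j∂_{w_j}`,
`E_{a3} ↦ Σ_j z_{aj}w_j`, `E_{3a} ↦ −Σ_j ∂_{z_{aj}}∂_{w_j}` (integral normalisation = genuine `+ ½tr` per line, so
`+ tr` here; see the module docstring). -/
noncomputable def planeOsc (i k : HarmVar) : Module.End ℂ PlaneModel := lineOsc 0 i k + lineOsc 1 i k


-- port_pkg: scope closed for this part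
end Plane
end Fock
end PerL34
end HodgeCM
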